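import Summits.CriticalPhenomena.PercolationContinuityZ3.Theses.PercNonProliferation
import Literature.Probability.Percolation.MinOpenCutMenger

/-!
# Crux-ideate sketch, round 2, ideator 6: crux `NonProliferation` (stmt-CriticalPhenomena-4444)

Card `biarmed-midsphere-pigeonhole` — first lemma and transfer targets.

Geometry (integers): small radius `q ≥ 1`, ratio `k ≥ 1`, crux index `n = 2kq`, free box `B(2n) = B(4kq)`,
inner box `B(n) = B(2kq)`, MID-SPHERE `S = ∂⁻B(3kq)`.  Every open crossing path from `B(n)` to `∂⁻B(2n)`
passes through `S` (discrete IVT for the sup-norm along lattice edges), and its passage point `w` is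
BI-ARMED: two open sub-paths from `w`, edge-disjoint, one reaching `B(n)` (sup-distance `≥ kq` from the patch
centre), one reaching `∂⁻B(2n)` (sup-distance `≥ kq`).  Cover `S` by `patchCount k = 6(3k+1)²` patches
`z + B(q)`; `N_n ≥ patchCount k + 1` distinct box-clusters force two DISTINCT clusters bi-armed through one
patch (`twoBi`), hence FOUR pairwise edge-disjoint open arms from `z + B(q)` to `∂⁻(z + B(kq))`
(`fourArm`, an INCREASING event), hence (BK) the square of the two-arm probability.

Everything is stated over existing declarations; `sorry` marks statements, not claims of proof.
-/

open Literature.Probability.LatticeModels Literature.Probability.Percolation MeasureTheory Filter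
open scoped Classical

noncomputable section

namespace Summit.CriticalPhenomena.PercolationContinuityZ3.Cruxes.NonProliferation.IdeateR2K6

/-- critical bond percolation on `ℤ³` -/
abbrev μc : Measure (BondConfig (Site 3)) := bondPercolation (zdGraph 3) (criticalProbI 3)

/-- the crux's encoding of `N_n ≥ k+1`: `k+1` points of `B(n)`, each joined inside `B(2n)` to `∂⁻B(2n)`,
pairwise NOT joined inside `B(2n)` (so `(reps M n)ᶜ` is verbatim the crux's event). -/
def reps (k n : ℕ) : Set (BondConfig (Site 3)) :=
  {ω | ∃ x : Fin (k + 1) → Site 3, (∀ i, x i ∈ box 3 n) ∧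
    (∀ i, ∃ y ∈ innerBoundary (zdGraph 3) (box 3 (2 * n)), ω ∈ openConnIn ↑(box 3 (2 * n)) (x i) y) ∧
    ∀ i j, i ≠ j → ω ∉ openConnIn ↑(box 3 (2 * n)) (x i) (x j)}

/-- the crux is `∃ M c, 0 < c ∧ ∃ᶠ n, c ≤ P((reps M n)ᶜ)` — definitionally -/
theorem crux_iff :
    Summit.CriticalPhenomena.PercolationContinuityZ3.Theses.PercNonProliferation.NonProliferation ↔
      ∃ (M : ℕ) (c : ℝ), 0 < c ∧ ∃ᶠ n : ℕ in atTop, c ≤ μc.real (reps M n)ᶜ :=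
  Iff.rfl

/-- the translated box `z + B(r)` as a set of sites -/
def ball (z : Site 3) (r : ℕ) : Set (Site 3) := {v | v - z ∈ box 3 r}

/-- the translated inner vertex boundary `∂⁻(z + B(r))` -/
def sphere (z : Site 3) (r : ℕ) : Set (Site 3) := {v | v - z ∈ innerBoundary (zdGraph 3) (box 3 r)}

/-- the open cluster of `x` INSIDE the region `S` (graph-free, through `openConnIn`) -/
def clusterIn (S : Set (Site 3)) (ω : BondConfig (Site 3)) (x : Site 3) : Set (Site 3) :=
  {v | ω ∈ openConnIn S x v}

/-- **`fourArm z q L`** (INCREASING): four pairwise edge-disjoint open walks inside `z + B(L)` from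
`z + B(q)` to `∂⁻(z + B(L))` — "max-flow from the small ball to distance `L` is at least 4". -/
def fourArm (z : Site 3) (q L : ℕ) : Set (BondConfig (Site 3)) :=
  {ω | (4 : ℕ∞) ≤ maxDisjointOpenPathsIn (ball z L) (ball z q) (sphere z L) ω}

/-- **`twoArm z q L`** (INCREASING): two edge-disjoint open walks inside `z + B(L)` from `z + B(q)` to
`∂⁻(z + B(L))` — the MONOCHROMATIC two-arm event from a ball (max-flow ≥ 2). -/
def twoArm (z : Site 3) (q L : ℕ) : Set (BondConfig (Site 3)) :=
  {ω | (2 : ℕ∞) ≤ maxDisjointOpenPathsIn (ball z L) (ball z q) (sphere z L) ω}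

/-- `x`'s cluster inside `z + B(L)` is BI-ARMED at ratio `L/q`: it contains two edge-disjoint open walks
from `z + B(q)` to `∂⁻(z + B(L))` (the region of `maxDisjointOpenPathsIn` is restricted to the cluster). -/
def BiArmed (z : Site 3) (q L : ℕ) (ω : BondConfig (Site 3)) (x : Site 3) : Prop :=
  (2 : ℕ∞) ≤ maxDisjointOpenPathsIn (ball z L ∩ clusterIn (ball z L) ω x) (ball z q) (sphere z L) ω

/-- **`twoBi z q L`** (the card's local event, NOT monotone): two points whose clusters inside `z + B(L)`
are DISTINCT and each bi-armed from `z + B(q)` to `∂⁻(z + B(L))` — a "(2+2)-arm polychromatic" event. -/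
def twoBi (z : Site 3) (q L : ℕ) : Set (BondConfig (Site 3)) :=
  {ω | ∃ x x' : Site 3, ω ∉ openConnIn (ball z L) x x' ∧ BiArmed z q L ω x ∧ BiArmed z q L ω x'}

/-- number of patches `z + B(q)` (centres `z ∈ ∂⁻B(3kq)` on a `(2q+1)`-grid) covering the mid-sphere -/
def patchCount (k : ℕ) : ℕ := 6 * (3 * k + 1) ^ 2

/-! ## First lemma (provable now): mid-sphere pigeonhole on bi-armed passage points -/

/-- **L1–L3 (deterministic).** For a configuration on lattice edges, `patchCount k + 1` pairwise box-distinct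
crossers of `A(2kq, 4kq)` force two DISTINCT clusters bi-armed through a common patch of the mid-sphere
`∂⁻B(3kq)`, at ratio `k` (arms from `z + B(q)` to `∂⁻(z + B(kq))`, and `z + B(kq) ⊆ B(4kq)`).
Proof sketch: each representative's open path to `∂⁻B(4kq)` meets `∂⁻B(3kq)` (sup-norm IVT, lattice steps);
its passage point splits the path into an inward and an outward arm, each reaching sup-distance `≥ kq` from the
patch centre; pigeonhole over the patches; paths of distinct representatives are vertex-disjoint. -/
theorem pigeonhole_twoBi (k q : ℕ) (hk : 1 ≤ k) (hq : 1 ≤ q) (ω : BondConfig (Site 3))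
    (hω : ω ⊆ (zdGraph 3).edgeSet) (h : ω ∈ reps (patchCount k) (2 * k * q)) :
    ∃ z ∈ innerBoundary (zdGraph 3) (box 3 (3 * k * q)), ω ∈ twoBi z q (k * q) := by
  sorry

/-- two distinct bi-armed clusters carry four pairwise edge-disjoint arms: `twoBi ⊆ fourArm` -/
theorem twoBi_subset_fourArm (z : Site 3) (q L : ℕ) : twoBi z q L ⊆ fourArm z q L := by
  sorry

/-- **L4 (union bound + shift invariance,** `bondPercolation_real_preimage_shift`**).**
`P(N_{2kq} ≥ patchCount k + 1) ≤ patchCount k · P(twoBi 0 q (kq))`. -/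
theorem real_reps_le_patchCount_mul (k q : ℕ) (hk : 1 ≤ k) (hq : 1 ≤ q) :
    μc.real (reps (patchCount k) (2 * k * q)) ≤ (patchCount k : ℝ) * μc.real (twoBi 0 q (k * q)) := by
  sorry

/-- **BK step (optional, monotone form):** `P(fourArm) ≤ P(twoArm)²` — four pairwise edge-disjoint arms are the
disjoint occurrence of two `twoArm` witnesses (`bk_finitary_list`). -/
theorem real_fourArm_le_sq (q L : ℕ) :
    μc.real (fourArm 0 q L) ≤ μc.real (twoArm 0 q L) ^ 2 := by
  sorry

/-! ## Transfer targets (the open, `d = 3` input), three nested forms -/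

/-- **C⁺ (primary, polychromatic): `TwoBiSparse`** — for ONE ratio `k`, along infinitely many small radii `q`,
two DISTINCT bi-armed clusters through a `q`-ball to distance `kq` are rarer than `1/patchCount k`:
`∃ k ≥ 1, ∃ c > 0, ∃ᶠ q, patchCount k · P(twoBi 0 q (kq)) ≤ 1 − c`.
Heuristic exponent: `P(twoBi 0 q (kq)) ≈ k^{-x}` with `x ≥ 2(3 − d_B) ≈ 2.26 > 2 = d − 1` (`d_B ≈ 1.87`, backbone
dimension), so `patchCount k · k^{-x} → 0`.  TRUE in the monolithic jump world (one giant ⇒ no second distinct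
bi-armed cluster), FALSE in jump ∧ FreeBoxSparse (proliferation) and for `d ≥ 7` (Aizenman). -/
def TwoBiSparse : Prop :=
  ∃ k : ℕ, 1 ≤ k ∧ ∃ c : ℝ, 0 < c ∧ ∃ᶠ q : ℕ in atTop,
    (patchCount k : ℝ) * μc.real (twoBi 0 q (k * q)) ≤ 1 - c

/-- **C⁺⁺ (monotone shadow): `FourArmSparse`** — the same with the INCREASING event `fourArm`
(max-flow ≥ 4 from `B(q)` to `∂⁻B(kq)`); implies `TwoBiSparse` by `twoBi_subset_fourArm`.
Exponent = monochromatic four-arm `x₄ ≥ 2 x₂ = 2(3 − d_B) ≈ 2.26 > 2`; morally false in EVERY `θ(p_c) > 0`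
world (a giant has large max-flow), i.e. continuity-strength — recorded, not recommended as the target. -/
def FourArmSparse : Prop :=
  ∃ k : ℕ, 1 ≤ k ∧ ∃ c : ℝ, 0 < c ∧ ∃ᶠ q : ℕ in atTop,
    (patchCount k : ℝ) * μc.real (fourArm 0 q (k * q)) ≤ 1 - c

/-- **C⁺⁺⁺ (one-ratio criterion via BK + shell submultiplicativity): `TwoArmOneScale`** —
`sup_q P(twoArm 0 q (k₀ q)) < 1/k₀` for ONE `k₀ ≥ 2` ("monochromatic two-arm exponent > 1 = (d−1)/2",
i.e. `d_B < 2`): submultiplicativity of `k ↦ sup_q P(twoArm 0 q (kq))` over independent shells upgrades it to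
`P(twoArm) ≤ (1−ε)^j k₀^{-j}` at `k = k₀^j`, and `real_fourArm_le_sq` gives `FourArmSparse`. -/
def TwoArmOneScale : Prop :=
  ∃ k₀ : ℕ, 2 ≤ k₀ ∧ ∃ ε : ℝ, 0 < ε ∧ ∀ q : ℕ, 1 ≤ q →
    (k₀ : ℝ) * μc.real (twoArm 0 q (k₀ * q)) ≤ 1 - ε

/-- **First lemma of the card: `TwoBiSparse → NonProliferation`** (from `real_reps_le_patchCount_mul`:
`P((reps (patchCount k) (2kq))ᶜ) ≥ c` frequently in `n = 2kq`; `crux_iff` with `M = patchCount k`). -/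
theorem nonProliferation_of_twoBiSparse (h : TwoBiSparse) :
    Summit.CriticalPhenomena.PercolationContinuityZ3.Theses.PercNonProliferation.NonProliferation := by
  sorry

/-- the monotone shadow suffices too -/
theorem nonProliferation_of_fourArmSparse (h : FourArmSparse) :
    Summit.CriticalPhenomena.PercolationContinuityZ3.Theses.PercNonProliferation.NonProliferation := by
  sorry

/-- and the one-ratio two-arm criterion suffices (BK + submultiplicativity + the above) -/
theorem nonProliferation_of_twoArmOneScale (h : TwoArmOneScale) :
    Summit.CriticalPhenomena.PercolationContinuityZ3.Theses.PercNonProliferation.NonProliferation := by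
  sorry

end Summit.CriticalPhenomena.PercolationContinuityZ3.Cruxes.NonProliferation.IdeateR2K6

end
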